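import Mathlib
import Literature.Computability.AlgebraicComplexity.FermionicPencil
import Literature.Computability.AlgebraicComplexity.FermionantCompletenessProofs
import Literature.Computability.AlgebraicComplexity.ValiantClassesProofs
import Summits.ValiantsHypothesis.ValiantsHypothesis.Theses.FermionicJet
import HarnessLib

/-!
# ValiantsHypothesis / FermionicJet — `JetChain`: the cycle jets form a chain under p-projections

Route `FermionicJet`, item `stmt-ValiantsHypothesis-5346` (support, rank 9). For the cycle jets
`f_{n,j} = ∑_σ sgn σ · binom(c(σ), j) · ∏ᵢ X_{σ i, i}` (`c(σ)` = number of cycles, fixed points included;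
`Literature.Computability.AlgebraicComplexity.cycleJetPoly (Fin n) ℂ j`, the `j`-th Taylor coefficient at
`t = 1` of the fermionic pencil `∑_σ sgn σ · t^{c(σ)} x^σ`), we prove that for every `k` the family
`(f_{n,k})_n` is a p-projection of `(f_{n,k+1})_n`, with `t(n) = n + k + 2`:
`f_{n,k}(X) = f_{n+k+2,k+1}(X ⊕ K)` for a constant `(k+2) × (k+2)` matrix `K`.

## Proof

* Jets are coefficients of the cycle-weighted cover sum over `R[X]`: for an `N × N` matrix `M`,
  `∑_σ sgn σ (1+X)^{c(σ)} M^σ = (-1)^N · cycW (-(1+X)) M` (`aeval_cycleJetPoly_eq_coeff_cycW`, the jet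
  analogue of `DeRugyAltherre.aeval_fermionicPencil_eq_cycW`), so `f_{N,j}(M) = (-1)^N coeff_j cycW`.
* The constant block is a *companion tower* attached on top of the generic matrix with NO edges to it:
  a hub (loop weight `u₀`), then chain vertices `v₁, …, v_{M-1}` with edge `v_{i-1} → v_i` (weight `1`),
  loop `-1` and back-edge `v_i → hub` (weight `u_i`). By the vertex elimination identity
  (`DeRugyAltherre.cycW_att1_single_single`) the cover sum obeys a Horner recursion, whence
  `cycW_b (tower) = b · p(-b) · cycW_b (base)` where `p ∈ ℤ[Y]` is the polynomial whose coefficients are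
  the weights (`cycW_tower_succ`; the weights are peeled off `p` by `Polynomial.divX`). No permutation
  combinatorics is needed.
* With `p = q / Y`, `q(Y) = (-1)^{M+1}(Y-1) - (Y-1)^M`, `M = k + 2`, one gets at `b = -(1+X)`:
  `cycW (tower) = ((-1)^k X + X^{k+2}) · cycW (base)`, so `coeff_{k+1}` of the big matrix is
  `(-1)^k coeff_k` of the base, i.e. `f_{n+k+2,k+1}(X ⊕ K) = f_{n,k}(X)` after the sign bookkeeping
  `(-1)^{n+k+2} (-1)^k = (-1)^n`.

All helpers live in the sub-namespace `…Theorems.FermionicJetJetChain` (the `def`s there — the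
iterated-`Option` vertex type `Tower`, the matrix `tower`, the weight polynomials `qPoly`/`pPoly`, the
substitution `subst` — are the explicit projection witness, not route objects); the closing theorem is
`Summit.ValiantsHypothesis.ValiantsHypothesis.Theorems.jetChain_proof`. (Advisory-audit `orphan` flags on
`hub`, `card_Tower`, `cycW_tower_updateRow`, `att1_map`, `VOC_intCast`, `VOC_neg_one` are artefacts: these
are used inside the pattern-matching recursions `tower`, `cycW_tower_succ`, `tower_map`, `tower_VOC` and
the abstracted proof in `eTower`.)
-/

noncomputable section

set_option linter.dupNamespace false -- single-conjunct summit: `ValiantsHypothesis.ValiantsHypothesis`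

open Equiv Equiv.Perm Finset Polynomial
open Literature.Computability.AlgebraicComplexity
open Literature.Computability.AlgebraicComplexity.DeRugyAltherre

namespace Summit.ValiantsHypothesis.ValiantsHypothesis.Theorems

namespace FermionicJetJetChain

/-! ### Jets as coefficients of the cycle-weighted cover sum over `R[X]` -/

section Jets

variable {K : Type*} [Field K]

/-- The cycle formula for the sign, jet form: `sgn τ · binom(c(τ), j) = (-1)^N (-1)^{c(τ)} binom(c(τ), j)`
for `τ ∈ S_N`. [folklore] -/
theorem sign_mul_choose_eq {N : ℕ} (τ : Perm (Fin N)) (j : ℕ) :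
    ((((Equiv.Perm.sign τ : ℤ) * (Nat.choose τ.numCycles j : ℕ)) : ℤ) : K) =
      (-1) ^ N * ((-1) ^ τ.numCycles * (Nat.choose τ.numCycles j : K)) := by
  have h := Equiv.Perm.sign_mul_neg_one_pow_numCycles τ
  rw [Fintype.card_fin] at h
  have h3 : (Equiv.Perm.sign τ : ℤ) = (-1) ^ N * (-1) ^ τ.numCycles := by
    calc (Equiv.Perm.sign τ : ℤ)
        = (Equiv.Perm.sign τ : ℤ) * ((-1) ^ τ.numCycles * (-1) ^ τ.numCycles) := by
          rw [← pow_add, ← two_mul, pow_mul, neg_one_sq, one_pow, mul_one]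
      _ = ((Equiv.Perm.sign τ : ℤ) * (-1) ^ τ.numCycles) * (-1) ^ τ.numCycles := by ring
      _ = (-1) ^ N * (-1) ^ τ.numCycles := by rw [h]
  have h4 : ((Equiv.Perm.sign τ : ℤ) : K) = ((-1 : K) ^ N) * ((-1 : K) ^ τ.numCycles) := by
    have := congrArg (Int.cast : ℤ → K) h3
    push_cast at this
    exact this
  push_cast
  rw [h4]
  ring

/-- **Jets are coefficients of the cycle-weighted cover sum.** Substituting the entries of a matrix `M`
(reindexed to `Fin N`) into the `j`-th cycle jet gives `(-1)^N` times the `X^j`-coefficient of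
`cycW (-(1+X)) M = ∑_σ (-(1+X))^{c(σ)} M^σ` computed over `R[X]`:
`∑_σ sgn σ binom(c(σ), j) M^σ = (-1)^N [X^j] ∑_σ (-1)^{c(σ)} (1+X)^{c(σ)} M^σ`. [folklore] -/
theorem aeval_cycleJetPoly_eq_coeff_cycW {ι : Type*} {W : Type*} [Fintype W] [DecidableEq W] {N : ℕ}
    (e : W ≃ Fin N) (M : Matrix W W (MvPolynomial ι K)) (j : ℕ) :
    MvPolynomial.aeval (fun pq : Fin N × Fin N => M (e.symm pq.1) (e.symm pq.2))
        (cycleJetPoly (Fin N) K j) =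
      MvPolynomial.C ((-1 : K) ^ N) *
        (cycW (-(1 + X) : (MvPolynomial ι K)[X]) (M.map Polynomial.C)).coeff j := by
  unfold cycleJetPoly cycW
  simp only [map_sum, map_mul, MvPolynomial.aeval_C, map_prod, MvPolynomial.aeval_X,
    MvPolynomial.algebraMap_eq, Polynomial.finsetSum_coeff]
  rw [Finset.mul_sum]
  refine Fintype.sum_equiv ((e.symm.permCongr).trans (Equiv.inv (Perm W))) _ _ fun τ => ?_
  simp only [Equiv.trans_apply, Equiv.inv_apply]
  rw [numCycles_inv, numCycles_permCongr]
  have hprod : ∏ i, M (e.symm (τ i)) (e.symm i) = ∏ w, M w ((e.symm.permCongr τ)⁻¹ w) := by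
    rw [← Fintype.prod_equiv (e.symm.permCongr τ) (fun v => M ((e.symm.permCongr τ) v) v)
      (fun w => M w ((e.symm.permCongr τ)⁻¹ w))
      (fun v => by rw [Equiv.Perm.inv_def, Equiv.symm_apply_apply])]
    exact Fintype.prod_equiv e.symm _ _ (fun i => by simp [Equiv.permCongr_apply])
  have hterm : ((-(1 + X : (MvPolynomial ι K)[X])) ^ τ.numCycles *
      ∏ i, (M.map Polynomial.C) i (((e.symm.permCongr τ)⁻¹) i)).coeff j =
      ((-1) ^ τ.numCycles * (Nat.choose τ.numCycles j : MvPolynomial ι K)) *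
        ∏ w, M w ((e.symm.permCongr τ)⁻¹ w) := by
    simp only [Matrix.map_apply]
    rw [← map_prod Polynomial.C, Polynomial.coeff_mul_C]
    have hneg : (-(1 + X) : (MvPolynomial ι K)[X]) ^ τ.numCycles =
        Polynomial.C ((-1 : MvPolynomial ι K) ^ τ.numCycles) * (1 + X) ^ τ.numCycles := by
      rw [neg_pow (1 + X : (MvPolynomial ι K)[X]), map_pow, map_neg, map_one]
    rw [hneg, Polynomial.coeff_C_mul, Polynomial.coeff_one_add_X_pow]
  rw [hprod, hterm, ← mul_assoc]
  congr 1
  have hC : ((-1 : MvPolynomial ι K) ^ τ.numCycles * (Nat.choose τ.numCycles j : MvPolynomial ι K)) =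
      MvPolynomial.C ((-1) ^ τ.numCycles * (Nat.choose τ.numCycles j : K)) := by
    simp
  rw [hC, ← map_mul, sign_mul_choose_eq]

end Jets

/-! ### The companion tower -/

section Tower

/-- `Tower V m = Option^m V`: the base vertex type with `m` new vertices attached one at a time.
[folklore] -/
def Tower (V : Type) : ℕ → Type
  | 0 => V
  | m + 1 => Option (Tower V m)

/-- `Tower V m` is finite. [folklore] -/
instance instFintypeTower (V : Type) [Fintype V] : (m : ℕ) → Fintype (Tower V m)
  | 0 => inferInstanceAs (Fintype V)
  | m + 1 => letI := instFintypeTower V m; inferInstanceAs (Fintype (Option (Tower V m)))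

/-- `Tower V m` has decidable equality. [folklore] -/
instance instDecidableEqTower (V : Type) [DecidableEq V] : (m : ℕ) → DecidableEq (Tower V m)
  | 0 => inferInstanceAs (DecidableEq V)
  | m + 1 => letI := instDecidableEqTower V m; inferInstanceAs (DecidableEq (Option (Tower V m)))

/-- `card (Tower V m) = card V + m`. [folklore] -/
theorem card_Tower (V : Type) [Fintype V] : ∀ m, Fintype.card (Tower V m) = Fintype.card V + m
  | 0 => rfl
  | m + 1 => by
    show @Fintype.card (Option (Tower V m)) (@instFintypeOption _ (instFintypeTower V m)) = _
    rw [Fintype.card_option, card_Tower V m, Nat.add_assoc]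

/-- The hub: the first attached vertex, seen at level `m + 1`. [folklore] -/
def hub (V : Type) : (m : ℕ) → Tower V (m + 1)
  | 0 => none
  | m + 1 => some (hub V m)

variable {R : Type*} [CommRing R] {V : Type} [Fintype V] [DecidableEq V]

/-- **The companion tower** on top of a base matrix `N₀` (no edges between the base and the new
vertices): attach the hub with loop weight `p₀` (level `1`), then at each further level a chain vertex
with in-edge from the previous top vertex (weight `1`), back-edge to the hub (weight the constant
coefficient of the current polynomial) and loop weight `-1`; the weights are the coefficients of
`p ∈ ℤ[Y]`, peeled off by `divX` from the top down. [folklore] -/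
def tower (N₀ : Matrix V V R) : (m : ℕ) → ℤ[X] → Matrix (Tower V m) (Tower V m) R
  | 0, _ => N₀
  | 1, p => att1 N₀ 0 0 ((p.coeff 0 : ℤ) : R)
  | m + 2, p => att1 (tower N₀ (m + 1) p.divX) (Pi.single none 1)
      (Pi.single (hub V m) ((p.coeff 0 : ℤ) : R)) (-1)

/-- Forcing the top vertex onto the hub: the cover sum is `b · cycW b N₀` (the forced cycle through all
attached vertices, times the covers of the base). [folklore] -/
theorem cycW_tower_updateRow (b : R) (N₀ : Matrix V V R) :
    ∀ (m : ℕ) (p : ℤ[X]),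
      cycW b ((tower N₀ (m + 1) p).updateRow none (Pi.single (hub V m) 1)) = b * cycW b N₀
  | 0, p => by
    show cycW (V := Option V) b ((att1 N₀ 0 0 ((p.coeff 0 : ℤ) : R)).updateRow none
      (Pi.single none 1)) = _
    rw [att1_updateRow_none_single_none, cycW_att1_row_zero, mul_one]
  | m + 1, p => by
    show cycW (V := Option (Tower V (m + 1))) b
      ((att1 (tower N₀ (m + 1) p.divX) (Pi.single none 1)
        (Pi.single (hub V m) ((p.coeff 0 : ℤ) : R)) (-1)).updateRow none
          (Pi.single (some (hub V m)) 1)) = _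
    rw [att1_updateRow_none_single_some, cycW_att1_single_single, cycW_tower_updateRow b N₀ m p.divX]
    ring

/-- **Cover sum of the companion tower** (Horner recursion from the vertex elimination identity):
`cycW b (tower N₀ (m+1) p) = b · p(-b) · cycW b N₀` whenever `deg p ≤ m` (`p(-b)` as `eval₂` along
`ℤ → R`). [folklore] -/
theorem cycW_tower_succ (b : R) (N₀ : Matrix V V R) :
    ∀ (m : ℕ) (p : ℤ[X]), p.natDegree ≤ m →
      cycW b (tower N₀ (m + 1) p) = b * p.eval₂ (Int.castRingHom R) (-b) * cycW b N₀
  | 0, p, hp => by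
    show cycW (V := Option V) b (att1 N₀ 0 0 ((p.coeff 0 : ℤ) : R)) = _
    rw [cycW_att1_row_zero]
    conv_rhs => rw [Polynomial.eq_C_of_natDegree_le_zero hp]
    rw [Polynomial.eval₂_C, eq_intCast]
  | m + 1, p, hp => by
    have hp' : p.divX.natDegree ≤ m := by
      rw [Polynomial.natDegree_divX_eq_natDegree_tsub_one]; omega
    show cycW (V := Option (Tower V (m + 1))) b
      (att1 (tower N₀ (m + 1) p.divX) (Pi.single none 1)
        (Pi.single (hub V m) ((p.coeff 0 : ℤ) : R)) (-1)) = _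
    rw [cycW_att1_single_single, cycW_tower_succ b N₀ m p.divX hp', cycW_tower_updateRow b N₀ m p.divX]
    conv_rhs => rw [← Polynomial.X_mul_divX_add p, Polynomial.eval₂_add, Polynomial.eval₂_mul,
      Polynomial.eval₂_X, Polynomial.eval₂_C, eq_intCast]
    ring

omit [Fintype V] [DecidableEq V] in
/-- `att1` commutes with ring homomorphisms. [folklore] -/
theorem att1_map {S : Type*} [CommRing S] (f : R →+* S) (N : Matrix V V R) (col row : V → R) (d : R) :
    (att1 N col row d).map f = att1 (N.map f) (f ∘ col) (f ∘ row) (f d) := by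
  ext (_ | i) (_ | j) <;> rfl

omit [Fintype V] in
/-- The companion tower commutes with ring homomorphisms (its new entries are `0, ±1` and integers).
[folklore] -/
theorem tower_map {S : Type*} [CommRing S] (f : R →+* S) (N₀ : Matrix V V R) :
    ∀ (m : ℕ) (p : ℤ[X]), (tower N₀ m p).map f = tower (N₀.map f) m p
  | 0, _ => rfl
  | 1, p => by
    show (att1 N₀ 0 0 ((p.coeff 0 : ℤ) : R)).map f = att1 (N₀.map f) 0 0 ((p.coeff 0 : ℤ) : S)
    rw [att1_map]
    congr 1
    · ext i; simp
    · ext i; simp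
    · simp
  | m + 2, p => by
    show (att1 (tower N₀ (m + 1) p.divX) (Pi.single none 1)
        (Pi.single (hub V m) ((p.coeff 0 : ℤ) : R)) (-1)).map f =
      att1 (tower (N₀.map f) (m + 1) p.divX) (Pi.single none 1)
        (Pi.single (hub V m) ((p.coeff 0 : ℤ) : S)) (-1)
    rw [att1_map, tower_map f N₀ (m + 1) p.divX]
    congr 1
    · ext i; simp [Pi.single_apply, apply_ite f]
    · ext i; simp [Pi.single_apply, apply_ite f]
    · simp

end Tower

/-! ### Entries are variables or constants -/

section VarOrConst

variable {K : Type*} [Field K] {ι : Type*} {V : Type} [Fintype V] [DecidableEq V]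

/-- An integer is a constant. [folklore] -/
theorem VOC_intCast (z : ℤ) : VOC ((z : ℤ) : MvPolynomial ι K) :=
  Or.inr ⟨(z : K), (map_intCast (MvPolynomial.C (σ := ι) (R := K)) z).symm⟩

/-- `-1` is a constant. [folklore] -/
theorem VOC_neg_one : VOC (-1 : MvPolynomial ι K) := Or.inr ⟨-1, by simp⟩

/-- The companion tower preserves "entries are variables or constants". [folklore] -/
theorem tower_VOC {N₀ : Matrix V V (MvPolynomial ι K)} (hN : ∀ i j, VOC (N₀ i j)) :
    ∀ (m : ℕ) (p : ℤ[X]) (x w : Tower V m), VOC (tower N₀ m p x w)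
  | 0, _, x, w => hN x w
  | 1, p, x, w =>
    att1_VOC hN (fun _ => VOC_zero) (fun _ => VOC_zero) (VOC_intCast (p.coeff 0)) x w
  | m + 2, p, x, w =>
    att1_VOC (tower_VOC hN (m + 1) p.divX) (fun a => VOC_single VOC_one _ a)
      (fun c => VOC_single (VOC_intCast (p.coeff 0)) _ c) VOC_neg_one x w

end VarOrConst

/-! ### The fan polynomial and the coefficient extraction -/

section Fan

/-- `q_M(Y) = (-1)^{M+1} (Y - 1) - (Y - 1)^M ∈ ℤ[Y]`: at `Y = 1 + X` this is `(-1)^{M+1} X - X^M`, the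
(signed) jet generating polynomial the companion block must have. [folklore] -/
def qPoly (M : ℕ) : ℤ[X] := Polynomial.C ((-1) ^ (M + 1)) * (X - Polynomial.C 1) - (X - Polynomial.C 1) ^ M

/-- The weight polynomial of the companion tower: `p_M = q_M / Y`. [folklore] -/
def pPoly (M : ℕ) : ℤ[X] := (qPoly M).divX

/-- `q_M(0) = 0`. [folklore] -/
theorem qPoly_coeff_zero (M : ℕ) : (qPoly M).coeff 0 = 0 := by
  rw [Polynomial.coeff_zero_eq_eval_zero, qPoly]
  simp only [eval_sub, eval_mul, eval_C, eval_X, eval_pow]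
  ring

/-- `deg q_M ≤ M` for `M ≥ 1`. [folklore] -/
theorem qPoly_natDegree_le (M : ℕ) (hM : 1 ≤ M) : (qPoly M).natDegree ≤ M := by
  unfold qPoly
  refine (Polynomial.natDegree_sub_le _ _).trans (max_le ?_ ?_)
  · refine (Polynomial.natDegree_C_mul_le _ _).trans ?_
    rw [Polynomial.natDegree_X_sub_C]
    exact hM
  · refine Polynomial.natDegree_pow_le.trans ?_
    rw [Polynomial.natDegree_X_sub_C, mul_one]

/-- `deg p_{k+2} ≤ k + 1`. [folklore] -/
theorem pPoly_natDegree_le (k : ℕ) : (pPoly (k + 2)).natDegree ≤ k + 1 := by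
  rw [pPoly, Polynomial.natDegree_divX_eq_natDegree_tsub_one]
  have := qPoly_natDegree_le (k + 2) (by omega)
  omega

/-- `Y · p_M = q_M`. [folklore] -/
theorem X_mul_pPoly (M : ℕ) : (X : ℤ[X]) * pPoly M = qPoly M := by
  have h := Polynomial.X_mul_divX_add (qPoly M)
  rwa [qPoly_coeff_zero, map_zero, add_zero] at h

/-- **The fan identity**: at `b = -(1+X)`, `b · p_{k+2}(-b) = (-1)^k X + X^{k+2}`. [folklore] -/
theorem fan_identity (S : Type*) [CommRing S] (k : ℕ) :
    (-(1 + X) : S[X]) * (pPoly (k + 2)).eval₂ (Int.castRingHom S[X]) (-(-(1 + X) : S[X])) =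
      Polynomial.C ((-1 : S) ^ k) * X + X ^ (k + 2) := by
  rw [neg_neg, neg_mul]
  have h : (1 + X : S[X]) * (pPoly (k + 2)).eval₂ (Int.castRingHom S[X]) (1 + X) =
      (qPoly (k + 2)).eval₂ (Int.castRingHom S[X]) (1 + X) := by
    rw [← X_mul_pPoly, Polynomial.eval₂_mul, Polynomial.eval₂_X]
  rw [h, qPoly, Polynomial.eval₂_sub, Polynomial.eval₂_mul, Polynomial.eval₂_pow, Polynomial.eval₂_sub,
    Polynomial.eval₂_C, Polynomial.eval₂_C, Polynomial.eval₂_X, map_pow, map_neg, map_one,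
    add_sub_cancel_left, map_pow, map_neg, map_one]
  ring

/-- Coefficient extraction: `[X^{k+1}] (((-1)^k X + X^{k+2}) · W) = (-1)^k [X^k] W`. [folklore] -/
theorem coeff_fan_mul (S : Type*) [CommRing S] (k : ℕ) (W : S[X]) :
    ((Polynomial.C ((-1 : S) ^ k) * X + X ^ (k + 2)) * W).coeff (k + 1) = (-1) ^ k * W.coeff k := by
  rw [add_mul, Polynomial.coeff_add, mul_assoc, Polynomial.coeff_C_mul, Polynomial.coeff_X_mul,
    Polynomial.coeff_X_pow_mul', if_neg (by omega), add_zero]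

/-- Sign bookkeeping: `(-1)^{n+k+2} (-1)^k = (-1)^n`. [folklore] -/
theorem neg_one_pow_add_mul (S : Type*) [CommRing S] (n k : ℕ) :
    ((-1 : S) ^ (n + (k + 2))) * (-1) ^ k = (-1) ^ n := by
  rw [pow_add, mul_assoc, ← pow_add, show k + 2 + k = 2 * (k + 1) by ring, pow_mul, neg_one_sq,
    one_pow, mul_one]

end Fan

/-! ### The projection -/

section Projection

variable (k n : ℕ)

/-- The matrix realising `f_{n,k}` as a projection of `f_{n+k+2,k+1}`: the generic `n × n` matrix with the
`(k+2)`-vertex companion tower of `p_{k+2}` attached. [folklore] -/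
def bigM : Matrix (Tower (Fin n) (k + 2)) (Tower (Fin n) (k + 2)) (MvPolynomial (Fin n × Fin n) ℂ) :=
  tower (Matrix.mvPolynomialX (Fin n) (Fin n) ℂ) (k + 2) (pPoly (k + 2))

/-- The reindexing of the tower vertex type to `Fin (n + (k + 2))`. [folklore] -/
def eTower : Tower (Fin n) (k + 2) ≃ Fin (n + (k + 2)) :=
  Fintype.equivFinOfCardEq (by rw [card_Tower, Fintype.card_fin])

/-- The substitution (entries of `bigM`, reindexed). [folklore] -/
def subst : Fin (n + (k + 2)) × Fin (n + (k + 2)) → MvPolynomial (Fin n × Fin n) ℂ :=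
  fun pq => bigM k n ((eTower k n).symm pq.1) ((eTower k n).symm pq.2)

/-- Every value of the substitution is a variable or a constant. [folklore] -/
theorem subst_VOC (pq : Fin (n + (k + 2)) × Fin (n + (k + 2))) : VOC (subst k n pq) := by
  unfold subst bigM
  exact tower_VOC (fun i j => by rw [Matrix.mvPolynomialX_apply]; exact VOC_X _) _ _ _ _

/-- The `k`-th jet of the generic matrix as a coefficient of its cycle-weighted cover sum. [folklore] -/
theorem cycleJetPoly_eq_coeff (j : ℕ) :
    cycleJetPoly (Fin n) ℂ j = MvPolynomial.C ((-1 : ℂ) ^ n) *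
      (cycW (-(1 + X) : (MvPolynomial (Fin n × Fin n) ℂ)[X])
        ((Matrix.mvPolynomialX (Fin n) (Fin n) ℂ).map Polynomial.C)).coeff j := by
  rw [← aeval_cycleJetPoly_eq_coeff_cycW (Equiv.refl (Fin n))]
  have : (fun pq : Fin n × Fin n =>
      Matrix.mvPolynomialX (Fin n) (Fin n) ℂ ((Equiv.refl (Fin n)).symm pq.1)
        ((Equiv.refl (Fin n)).symm pq.2)) = MvPolynomial.X := by
    funext pq
    simp [Matrix.mvPolynomialX_apply]
  rw [this, MvPolynomial.aeval_X_left_apply]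

/-- **The jet chain identity**: `f_{n,k} = f_{n+k+2,k+1}(X ⊕ K)`. [folklore] -/
theorem cycleJetPoly_eq_aeval_subst :
    cycleJetPoly (Fin n) ℂ k =
      MvPolynomial.aeval (subst k n) (cycleJetPoly (Fin (n + (k + 2))) ℂ (k + 1)) := by
  unfold subst
  rw [aeval_cycleJetPoly_eq_coeff_cycW (eTower k n) (bigM k n) (k + 1), bigM,
    tower_map, cycW_tower_succ _ _ (k + 1) _ (pPoly_natDegree_le k), fan_identity, coeff_fan_mul,
    cycleJetPoly_eq_coeff n k, ← mul_assoc]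
  congr 1
  rw [show ((-1 : MvPolynomial (Fin n × Fin n) ℂ) ^ k) = MvPolynomial.C ((-1 : ℂ) ^ k) by simp,
    ← map_mul, neg_one_pow_add_mul]

end Projection

end FermionicJetJetChain

open FermionicJetJetChain in
/-- Settles `stmt-ValiantsHypothesis-5346` (`JetChain`, route `FermionicJet`): for every order `k`, the
cycle-jet family `(f_{n,k})_n`, `f_{n,k} = ∑_σ sgn σ · binom(c(σ), k) · ∏ᵢ X_{σ i, i}`, is a p-projection of
`(f_{n,k+1})_n`, with `t(n) = n + k + 2`: `f_{n,k}(X) = f_{n+k+2,k+1}(X ⊕ K)` for the constant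
`(k+2) × (k+2)` companion ("fan") matrix `K` whose jet generating polynomial is `X + (-1)^k X^{k+2}`
(jets convolve over blocks). Hence easiness propagates down the jet order and hardness up. [folklore] -/
theorem jetChain_proof : Summit.ValiantsHypothesis.ValiantsHypothesis.Theses.FermionicJet.JetChain := by
  intro k
  refine ⟨fun n => n + (k + 2), IsPBounded.add_holds IsPBounded.id (IsPBounded.const (k + 2)),
    fun n => ⟨subst k n, subst_VOC k n, ?_⟩⟩
  exact cycleJetPoly_eq_aeval_subst k n

end Summit.ValiantsHypothesis.ValiantsHypothesis.Theorems
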